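import Literature.AlgebraicGeometry.Motives.HodgeGroupKernelMultiplierCharacter
import HarnessLib

/-!
# Commutators of `MT(H)(ℚ)` lie in `Hg(H)(ℚ)` (odd weight, polarizable), on `ℚ`-points

Layer `Literature/AlgebraicGeometry/Motives`; family `hodge`. Theorems only; no definition, no named fact
(net debt `0`). A ten-line consequence of the foundations library (`lit-hodgefound`):
`Polarization.multiplierCharRat : MT(H)(ℚ) →* ℚˣ` (`Motives/MumfordTateMultiplierCharacter`) and
`Polarization.mem_hodgeGroup_iff_of_odd` (`Motives/HodgeGroupKernelMultiplierCharacter`: in odd weight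
`Hg(H)(ℚ) = MT(H)(ℚ) ∩ Sp(V, Q)`), recorded because the route
`Summits/HodgeConjecture/HodgeConjecture/Theses/SignSymmetricPowers.lean` (crux K1
`VeryGeneralSignCommutatorsInHg`, weight `3`) concludes "`g h g⁻¹ h⁻¹ ∈ hodgeGroup`" from
"`g, h ∈` (a group contained in) `mumfordTateGroup`" (Deligne–André: `Mon_s ⊆ MT`).

Moonen, *Notes on Mumford–Tate groups* (1999), (1.7): "`MT(V)` acts on it [the line spanned by `φ`]
through some character `ν : MT(V) → 𝔾_{m,ℚ}`. The conclusion is that `MT(V) ⊆ GSp(V, φ)` if `n` is odd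
[…] The kernel of this character"; Moonen, *An introduction to Mumford–Tate groups* (2004), (5.8):
"`Hg(X) := Ker(MT(X) ↪ CSp(V, φ) —ν→ 𝔾_m)` […] Equivalently: `Hg(X) := MT(X) ∩ Sp(V, φ)`." Since `ν` is a
homomorphism to the commutative group `ℚˣ`, `ν(g h g⁻¹ h⁻¹) = 1`, so commutators of `MT(H)(ℚ)` preserve
`Q` and lie in `Hg(H)(ℚ)`:

* `Polarization.form_commutator` (`Q([g,h] v, [g,h] w) = Q(v, w)` for `g, h ∈ MT(H)(ℚ)`, any weight),
* **`Polarization.commutator_mem_hodgeGroup_of_odd`**, `commutator_mem_hodgeGroup_of_isPolarizable_of_odd`,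
* `Polarization.commutator_mumfordTateGroup_le_hodgeGroup_of_odd` (`⁅MT(H)(ℚ), MT(H)(ℚ)⁆ ≤ Hg(H)(ℚ)`),
  `commutator_mumfordTateGroup_le_hodgeGroup_of_isPolarizable_of_odd`.

(Even weight `n ≠ 0` is not treated: there `ν = 1` only gives `[g,h] ∈ Hg ∪ (−1)·Hg` on points,
`Motives/MumfordTateGroupPointsDirectProduct`.)

## References

* [Moonen1999MTNotes] B. Moonen, Notes on Mumford–Tate groups (1999), (1.7).
* [Moonen2004MT] B. Moonen, An introduction to Mumford–Tate groups (2004), (5.8).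
* [CarlsonMullerStachPeters2017] J. Carlson, S. Müller-Stach, C. Peters, Period Mappings and Period Domains,
  2nd ed. (2017), §15.2 Remark (ii), Corollary 15.3.10.
-/

noncomputable section

namespace Literature.AlgebraicGeometry.Motives

namespace HodgeStructure

universe u

variable {V : Type u} [AddCommGroup V] [Module ℚ V] [Module.Finite ℚ V] [HodgeTensorFacts.{u, u}] {n : ℤ}
  {H : HodgeStructure V n}

/-- **Commutators of `MT(H)(ℚ)` preserve the polarization** (any weight): `ν` is a homomorphism to the
commutative group `ℚˣ`, so `ν(g h g⁻¹ h⁻¹) = 1`. [cite: Moonen1999MTNotes, (1.7)] -/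
theorem Polarization.form_commutator [Nontrivial V] (Q : Polarization H) {g h : V ≃ₗ[ℚ] V}
    (hg : g ∈ H.mumfordTateGroup) (hh : h ∈ H.mumfordTateGroup) (v w : V) :
    Q.form ((g * h * g⁻¹ * h⁻¹) v) ((g * h * g⁻¹ * h⁻¹) w) = Q.form v w := by
  set g' : H.mumfordTateGroup := ⟨g, hg⟩
  set h' : H.mumfordTateGroup := ⟨h, hh⟩
  have hν : Q.multiplierCharRat (g' * h' * g'⁻¹ * h'⁻¹) = 1 := by
    rw [map_mul, map_mul, map_mul, map_inv, map_inv, mul_inv_cancel_comm, mul_inv_cancel]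
  have hf := Q.form_multiplierCharRat (g' * h' * g'⁻¹ * h'⁻¹) v w
  rw [hν, Units.val_one, one_mul] at hf
  exact hf

/-- **Commutators of `MT(H)(ℚ)` lie in `Hg(H)(ℚ)`, odd weight** (`Hg = MT ∩ Sp(V, Q)` on rational points,
Moonen (5.8), and `ν([g,h]) = 1`). [cite: Moonen2004MT, (5.8)] [cite: Moonen1999MTNotes, (1.7)] -/
theorem Polarization.commutator_mem_hodgeGroup_of_odd [Nontrivial V] (hn : Odd n) (Q : Polarization H)
    {g h : V ≃ₗ[ℚ] V} (hg : g ∈ H.mumfordTateGroup) (hh : h ∈ H.mumfordTateGroup) :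
    g * h * g⁻¹ * h⁻¹ ∈ H.hodgeGroup :=
  (Q.mem_hodgeGroup_iff_of_odd hn _).2
    ⟨H.mumfordTateGroup.mul_mem (H.mumfordTateGroup.mul_mem (H.mumfordTateGroup.mul_mem hg hh)
      (H.mumfordTateGroup.inv_mem hg)) (H.mumfordTateGroup.inv_mem hh), Q.form_commutator hg hh⟩

/-- Commutators of `MT(H)(ℚ)` lie in `Hg(H)(ℚ)` for a POLARIZABLE Hodge structure of odd weight.
[cite: Moonen2004MT, (5.8)] -/
theorem commutator_mem_hodgeGroup_of_isPolarizable_of_odd [Nontrivial V] (hH : H.IsPolarizable) (hn : Odd n)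
    {g h : V ≃ₗ[ℚ] V} (hg : g ∈ H.mumfordTateGroup) (hh : h ∈ H.mumfordTateGroup) :
    g * h * g⁻¹ * h⁻¹ ∈ H.hodgeGroup := by
  obtain ⟨Q⟩ := hH
  exact Q.commutator_mem_hodgeGroup_of_odd hn hg hh

/-- **`⁅MT(H)(ℚ), MT(H)(ℚ)⁆ ≤ Hg(H)(ℚ)`** in odd weight (CMSP: "`MT(𝒫)^der`" sits in the special
Mumford–Tate group). [cite: Moonen2004MT, (5.8)] [cite: CarlsonMullerStachPeters2017, Corollary 15.3.10] -/
theorem Polarization.commutator_mumfordTateGroup_le_hodgeGroup_of_odd [Nontrivial V] (hn : Odd n)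
    (Q : Polarization H) : ⁅H.mumfordTateGroup, H.mumfordTateGroup⁆ ≤ H.hodgeGroup :=
  Subgroup.commutator_le.2 fun _ hg _ hh => by
    rw [commutatorElement_def]
    exact Q.commutator_mem_hodgeGroup_of_odd hn hg hh

/-- `⁅MT(H)(ℚ), MT(H)(ℚ)⁆ ≤ Hg(H)(ℚ)` for a polarizable Hodge structure of odd weight. [cite: Moonen2004MT, (5.8)] -/
theorem commutator_mumfordTateGroup_le_hodgeGroup_of_isPolarizable_of_odd [Nontrivial V] (hH : H.IsPolarizable)
    (hn : Odd n) : ⁅H.mumfordTateGroup, H.mumfordTateGroup⁆ ≤ H.hodgeGroup := by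
  obtain ⟨Q⟩ := hH
  exact Q.commutator_mumfordTateGroup_le_hodgeGroup_of_odd hn

end HodgeStructure

end Literature.AlgebraicGeometry.Motives
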